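import Literature.Analysis.Calculus.SimpleRootBranch               -- ★ p851543 (F0P3a-p04): `exists_contDiffOn_quadraticRoot_near`, `Complex.exists_contDiffOn_arg_near`, `contDiffAt_log_norm`
import Literature.Analysis.Calculus.SimpleRootBranchCubic          -- ★ p851971 (F0P3a-p04 (g27)): `exists_contDiffOn_cubicRoot_near` (one simple root of a monic cubic, IFT)
import HarnessLib

/-!
# THREE smooth local root branches of a monic CUBIC with simple roots, with the VIETA identities — deflation over ★ `SimpleRootBranchCubic` (Ahlfors, *Complex Analysis*, Ch. 8 §2)

Topic `Analysis/Calculus`; namespace `Literature.Analysis.Calculus`.  THEOREMS ONLY (no `def`, no instance, no notation, no axiom, no named fact, no `sorry`).  Cell `pub/hodgecm-mathlib`,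
crux H413 (`stmt-HodgeConjecture-24833`), road «N8-INNER» brick (7) «(Σ-REG-G)», file F3 `ArchBouazizClassMapSectionG` (dealer LH2-plan (g1) DEAL 2026-09-02T15:59:55Z → LH10-p02 (g9); engine ★ p851971 by F0P3a-p04 (g27)):
the ANALYTIC INPUT of the smooth local section of the `G`-side class map `(σ₁, σ₂, σ₃)` = the elementary symmetric functions of THREE eigenvalues (the `U(2,1)`∕`U(3)` charts have
three slots; ★ `SimpleRootBranch` covers the two-slot `H`-charts with the explicit quadratic formula).  Count-neutral calculus plumbing.

* §1 (★ p851971 `exists_contDiffOn_cubicRoot_near`, F0P3a-p04 (g27), imported): ONE simple root of `z³ − σ₁z² + σ₂z − σ₃` is a `C^∞` function of `σ` near `σ⁰`.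
* §2 `cubic_eq_mul_quadratic` — DEFLATION: `p(λ) = 0 ⇒ z³ − σ₁z² + σ₂z − σ₃ = (z − λ)(z² − (σ₁ − λ)z + (σ₂ − σ₁λ + λ²))`.
* §3 **`exists_contDiffOn_cubicRoots_near`** — near `σ⁰` whose cubic has THREE DISTINCT roots `λ₁, λ₂, λ₃`, there are three `C^∞` root branches `r₁, r₂, r₃` through them with the
  FULL VIETA IDENTITIES `r₁ + r₂ + r₃ = σ₁`, `r₁r₂ + r₁r₃ + r₂r₃ = σ₂`, `r₁r₂r₃ = σ₃` at EVERY point of the neighbourhood (so `{r₁, r₂, r₃}(σ)` IS the root multiset — no continuity-of-roots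
  theorem is needed) and pairwise distinct values: §1 for `r₁`, then ★ `exists_contDiffOn_quadraticRoot_near` on the deflated quadratic (§2), whose discriminant at `σ⁰` is
  `(λ₂ − λ₃)² ≠ 0`.
HONEST LABEL: HC_CM is proved only modulo the 7 printed citations (2 remaining: hLiu418 = stmt-HodgeConjecture-24832, h413 = stmt-HodgeConjecture-24833) until rung 0 closes; this file moves no row.

## References
* [Ahlfors1979] L. V. Ahlfors, *Complex Analysis*, 3rd ed. (1979), Ch. 8 §2 (simple roots depend analytically on the coefficients).
* [Dieudonne1960] J. Dieudonné, *Foundations of Modern Analysis* (1960), Ch. X §2 (10.2.1)–(10.2.3) (implicit function theorem).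
-/

set_option autoImplicit false

noncomputable section

open Complex Set Topology
open scoped ContDiff

namespace Literature.Analysis.Calculus

/-! ## §1 Deflation -/

/-- **DEFLATION**: if `p(λ) = 0` then `z³ − σ₁z² + σ₂z − σ₃ = (z − λ)(z² − (σ₁ − λ)z + (σ₂ − σ₁λ + λ²))` for every `z`. [cite: Ahlfors1979, Ch. 8 §2] -/
theorem cubic_eq_mul_quadratic {σ : ℂ × ℂ × ℂ} {lam : ℂ} (hlam : lam ^ 3 - σ.1 * lam ^ 2 + σ.2.1 * lam - σ.2.2 = 0) (z : ℂ) :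
    z ^ 3 - σ.1 * z ^ 2 + σ.2.1 * z - σ.2.2 = (z - lam) * (z ^ 2 - (σ.1 - lam) * z + (σ.2.1 - σ.1 * lam + lam ^ 2)) := by
  linear_combination hlam

/-- The derivative of the cubic at a root is the product of the root differences: with `λ₁ + λ₂ + λ₃ = σ₁`, `λ₁λ₂ + λ₁λ₃ + λ₂λ₃ = σ₂`, `3λ₁² − 2σ₁λ₁ + σ₂ = (λ₁ − λ₂)(λ₁ − λ₃)`.
[cite: Ahlfors1979, Ch. 8 §2] -/
theorem cubicDeriv_eq_of_vieta {σ₁ σ₂ l₁ l₂ l₃ : ℂ} (h1 : l₁ + l₂ + l₃ = σ₁) (h2 : l₁ * l₂ + l₁ * l₃ + l₂ * l₃ = σ₂) :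
    3 * l₁ ^ 2 - 2 * σ₁ * l₁ + σ₂ = (l₁ - l₂) * (l₁ - l₃) := by
  rw [← h1, ← h2]; ring

/-! ## §2 Three smooth root branches with the Vieta identities -/

/-- **THREE SMOOTH ROOT BRANCHES OF A MONIC CUBIC WITH SIMPLE ROOTS, WITH THE FULL VIETA IDENTITIES.**  If at `σ⁰` the cubic `z³ − σ₁⁰z² + σ₂⁰z − σ₃⁰` has the three pairwise distinct roots
`λ₁, λ₂, λ₃` (given through Vieta: `Σλ = σ₁⁰`, `Σλλ′ = σ₂⁰`, `λ₁λ₂λ₃ = σ₃⁰`), then on an open neighbourhood `U ∋ σ⁰` there are `C^∞` functions `r₁, r₂, r₃` with `r_k σ⁰ = λ_k`, pairwise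
distinct values, and `r₁ + r₂ + r₃ = σ₁`, `r₁r₂ + r₁r₃ + r₂r₃ = σ₂`, `r₁r₂r₃ = σ₃` IDENTICALLY on `U` — so for every `σ ∈ U`, `z³ − σ₁z² + σ₂z − σ₃ = (z − r₁σ)(z − r₂σ)(z − r₃σ)`: the three
branches ARE the roots, with no continuity-of-roots theorem invoked (★ `exists_contDiffOn_cubicRoot_near` for `r₁`; ★ `exists_contDiffOn_quadraticRoot_near` on the deflated quadratic of §1, whose
discriminant at `σ⁰` is `(λ₂ − λ₃)²`). [cite: Ahlfors1979, Ch. 8 §2] [cite: Dieudonne1960, Ch. X §2 (10.2.1)–(10.2.3)] -/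
theorem exists_contDiffOn_cubicRoots_near {σ₀ : ℂ × ℂ × ℂ} {l₁ l₂ l₃ : ℂ} (h1 : l₁ + l₂ + l₃ = σ₀.1) (h2 : l₁ * l₂ + l₁ * l₃ + l₂ * l₃ = σ₀.2.1) (h3 : l₁ * l₂ * l₃ = σ₀.2.2)
    (h12 : l₁ ≠ l₂) (h13 : l₁ ≠ l₃) (h23 : l₂ ≠ l₃) :
    ∃ U : Set (ℂ × ℂ × ℂ), IsOpen U ∧ σ₀ ∈ U ∧ ∃ r₁ r₂ r₃ : ℂ × ℂ × ℂ → ℂ,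
      ContDiffOn ℝ ∞ r₁ U ∧ ContDiffOn ℝ ∞ r₂ U ∧ ContDiffOn ℝ ∞ r₃ U ∧ r₁ σ₀ = l₁ ∧ r₂ σ₀ = l₂ ∧ r₃ σ₀ = l₃ ∧
      (∀ σ ∈ U, r₁ σ + r₂ σ + r₃ σ = σ.1 ∧ r₁ σ * r₂ σ + r₁ σ * r₃ σ + r₂ σ * r₃ σ = σ.2.1 ∧ r₁ σ * r₂ σ * r₃ σ = σ.2.2) ∧
      (∀ σ ∈ U, r₁ σ ≠ r₂ σ ∧ r₁ σ ≠ r₃ σ ∧ r₂ σ ≠ r₃ σ) := by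
  -- the branch through `λ₁` (★ IFT)
  have hlam : l₁ ^ 3 - σ₀.1 * l₁ ^ 2 + σ₀.2.1 * l₁ - σ₀.2.2 = 0 := by rw [← h1, ← h2, ← h3]; ring
  have hsimple : 3 * l₁ ^ 2 - 2 * σ₀.1 * l₁ + σ₀.2.1 ≠ 0 := by
    rw [cubicDeriv_eq_of_vieta h1 h2]; exact mul_ne_zero (sub_ne_zero.2 h12) (sub_ne_zero.2 h13)
  obtain ⟨U₁, hU₁o, hU₁, r₁, hr₁s, hr₁0, hr₁root⟩ := exists_contDiffOn_cubicRoot_near hlam hsimple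
  -- the deflated quadratic `z² − t(σ) z + d(σ)`, `t = σ₁ − r₁`, `d = σ₂ − σ₁ r₁ + r₁²`; at `σ⁰`: `t = λ₂ + λ₃`, `d = λ₂λ₃`
  set t : ℂ × ℂ × ℂ → ℂ := fun σ => σ.1 - r₁ σ with ht
  set d : ℂ × ℂ × ℂ → ℂ := fun σ => σ.2.1 - σ.1 * r₁ σ + r₁ σ ^ 2 with hd
  have ht0 : t σ₀ = l₂ + l₃ := by simp only [ht, hr₁0]; rw [← h1]; ring
  have hd0 : d σ₀ = l₂ * l₃ := by simp only [hd, hr₁0]; rw [← h1, ← h2]; ring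
  have hq2 : l₂ ^ 2 - t σ₀ * l₂ + d σ₀ = 0 := by rw [ht0, hd0]; ring
  have hdisc : t σ₀ ^ 2 - 4 * d σ₀ ≠ 0 := by
    rw [ht0, hd0]
    have : (l₂ + l₃) ^ 2 - 4 * (l₂ * l₃) = (l₂ - l₃) ^ 2 := by ring
    rw [this]; exact pow_ne_zero _ (sub_ne_zero.2 h23)
  obtain ⟨V, hVo, hV0, q, hqs, hq0, hqroot⟩ := exists_contDiffOn_quadraticRoot_near hq2 hdisc
  -- the coefficient map `σ ↦ (t σ, d σ)` is smooth on `U₁` and continuous there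
  have htd : ContDiffOn ℝ ∞ (fun σ => (t σ, d σ)) U₁ := by
    refine ContDiffOn.prodMk ?_ ?_
    · exact contDiff_fst.contDiffOn.sub hr₁s
    · exact ((contDiff_snd.fst).contDiffOn.sub (contDiff_fst.contDiffOn.mul hr₁s)).add (hr₁s.pow 2)
  -- the neighbourhood: `U₁ ∩ (t,d)⁻¹ V`, then shrink to keep the three values pairwise distinct
  set U₂ : Set (ℂ × ℂ × ℂ) := U₁ ∩ (fun σ => (t σ, d σ)) ⁻¹' V with hU₂
  have hU₂o : IsOpen U₂ := htd.continuousOn.isOpen_inter_preimage hU₁o hVo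
  have hU₂0 : σ₀ ∈ U₂ := ⟨hU₁, hV0⟩
  set r₂ : ℂ × ℂ × ℂ → ℂ := fun σ => q (t σ, d σ) with hr₂
  set r₃ : ℂ × ℂ × ℂ → ℂ := fun σ => t σ - q (t σ, d σ) with hr₃
  have hr₂s : ContDiffOn ℝ ∞ r₂ U₂ := hqs.comp (htd.mono inter_subset_left) fun σ hσ => hσ.2
  have hr₃s : ContDiffOn ℝ ∞ r₃ U₂ := ((contDiff_fst.contDiffOn.sub hr₁s).mono inter_subset_left).sub hr₂s
  have hr₂0 : r₂ σ₀ = l₂ := by simp only [hr₂]; exact hq0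
  have hr₃0 : r₃ σ₀ = l₃ := by simp only [hr₃]; rw [hq0, ht0]; ring
  -- Vieta on `U₂`
  have hvieta : ∀ σ ∈ U₂, r₁ σ + r₂ σ + r₃ σ = σ.1 ∧ r₁ σ * r₂ σ + r₁ σ * r₃ σ + r₂ σ * r₃ σ = σ.2.1 ∧ r₁ σ * r₂ σ * r₃ σ = σ.2.2 := by
    intro σ hσ
    have hroot := hr₁root σ hσ.1
    have hq := (hqroot _ hσ.2).2   -- `q · (t − q) = d`
    simp only [] at hq
    refine ⟨by simp only [hr₂, hr₃, ht]; ring, ?_, ?_⟩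
    · -- `r₁ (r₂ + r₃) + r₂ r₃ = r₁ t + d = σ₂`
      have : r₁ σ * r₂ σ + r₁ σ * r₃ σ + r₂ σ * r₃ σ = r₁ σ * t σ + q (t σ, d σ) * (t σ - q (t σ, d σ)) := by simp only [hr₂, hr₃]; ring
      rw [this, hq]; simp only [ht, hd]; ring
    · have : r₁ σ * r₂ σ * r₃ σ = r₁ σ * (q (t σ, d σ) * (t σ - q (t σ, d σ))) := by simp only [hr₂, hr₃]; ring
      rw [this, hq]; simp only [hd]
      linear_combination hroot
  -- distinctness near `σ⁰` by continuity
  have hcont : ∀ {f : ℂ × ℂ × ℂ → ℂ}, ContDiffOn ℝ ∞ f U₂ → ContinuousOn f U₂ := fun hf => hf.continuousOn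
  have hne : ∀ {f g : ℂ × ℂ × ℂ → ℂ}, ContDiffOn ℝ ∞ f U₂ → ContDiffOn ℝ ∞ g U₂ → f σ₀ ≠ g σ₀ → ∃ O : Set (ℂ × ℂ × ℂ), IsOpen O ∧ σ₀ ∈ O ∧ ∀ σ ∈ O ∩ U₂, f σ ≠ g σ := by
    intro f g hf hg h0
    have hc : ContinuousOn (fun σ => f σ - g σ) U₂ := (hcont hf).sub (hcont hg)
    obtain ⟨O, hOo, hO⟩ := (_root_.continuousOn_iff'.1 hc) {z : ℂ | z ≠ 0} isOpen_ne
    refine ⟨O, hOo, ?_, fun σ hσ => ?_⟩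
    · have : σ₀ ∈ (fun σ => f σ - g σ) ⁻¹' {z : ℂ | z ≠ 0} ∩ U₂ := ⟨sub_ne_zero.2 h0, hU₂0⟩
      rw [hO] at this; exact this.1
    · have : σ ∈ O ∩ U₂ := hσ
      rw [← hO] at this
      exact sub_ne_zero.1 this.1
  obtain ⟨O₁, hO₁o, hO₁0, hO₁⟩ := hne (hr₁s.mono inter_subset_left) hr₂s (by rw [hr₁0, hr₂0]; exact h12)
  obtain ⟨O₂, hO₂o, hO₂0, hO₂⟩ := hne (hr₁s.mono inter_subset_left) hr₃s (by rw [hr₁0, hr₃0]; exact h13)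
  obtain ⟨O₃, hO₃o, hO₃0, hO₃⟩ := hne hr₂s hr₃s (by rw [hr₂0, hr₃0]; exact h23)
  refine ⟨U₂ ∩ (O₁ ∩ O₂ ∩ O₃), hU₂o.inter ((hO₁o.inter hO₂o).inter hO₃o), ⟨hU₂0, ⟨hO₁0, hO₂0⟩, hO₃0⟩, r₁, r₂, r₃,
    (hr₁s.mono inter_subset_left).mono inter_subset_left, hr₂s.mono inter_subset_left, hr₃s.mono inter_subset_left, hr₁0, hr₂0, hr₃0,
    fun σ hσ => hvieta σ hσ.1, fun σ hσ => ⟨hO₁ σ ⟨hσ.2.1.1, hσ.1⟩, hO₂ σ ⟨hσ.2.1.2, hσ.1⟩, hO₃ σ ⟨hσ.2.2, hσ.1⟩⟩⟩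

/-- **The factorisation reading**: under the Vieta identities, `z³ − σ₁z² + σ₂z − σ₃ = (z − r₁)(z − r₂)(z − r₃)`. [cite: Ahlfors1979, Ch. 8 §2] -/
theorem cubic_eq_prod_of_vieta {σ₁ σ₂ σ₃ r₁ r₂ r₃ : ℂ} (h1 : r₁ + r₂ + r₃ = σ₁) (h2 : r₁ * r₂ + r₁ * r₃ + r₂ * r₃ = σ₂) (h3 : r₁ * r₂ * r₃ = σ₃) (z : ℂ) :
    z ^ 3 - σ₁ * z ^ 2 + σ₂ * z - σ₃ = (z - r₁) * (z - r₂) * (z - r₃) := by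
  rw [← h1, ← h2, ← h3]; ring

/-- **Root identification**: under the Vieta identities with pairwise distinct `r_k`, every root of the cubic is one of `r₁, r₂, r₃`. [cite: Ahlfors1979, Ch. 8 §2] -/
theorem eq_or_eq_or_eq_of_cubic_eq_zero {σ₁ σ₂ σ₃ r₁ r₂ r₃ : ℂ} (h1 : r₁ + r₂ + r₃ = σ₁) (h2 : r₁ * r₂ + r₁ * r₃ + r₂ * r₃ = σ₂) (h3 : r₁ * r₂ * r₃ = σ₃)
    {z : ℂ} (hz : z ^ 3 - σ₁ * z ^ 2 + σ₂ * z - σ₃ = 0) : z = r₁ ∨ z = r₂ ∨ z = r₃ := by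
  rw [cubic_eq_prod_of_vieta h1 h2 h3 z] at hz
  rcases mul_eq_zero.1 hz with h | h
  · rcases mul_eq_zero.1 h with h | h
    · exact Or.inl (sub_eq_zero.1 h)
    · exact Or.inr (Or.inl (sub_eq_zero.1 h))
  · exact Or.inr (Or.inr (sub_eq_zero.1 h))

end Literature.Analysis.Calculus

end
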